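import Summits.BirchSwinnertonDyer.BirchSwinnertonDyer.Theorems.KimAtThreeKolyvaginCertificateDictionary
import HarnessLib

/-!
# Route `KimAtThreeKolyvagin` (rung W2), crux `ShallowEqDeepAtTorsionFree`: the EXACT UNIFORM DICTIONARY theorem

Item `stmt-BirchSwinnertonDyer-19077` asks, on every row of the route (tower onto, `E(ℚ₃)[3] = 0`,
`Ш` finite, newform `f` with `3`-integral plus symbols, `ord(δ̃) = 0`), for
`∂^{(∞)}_{deep}(δ̃) ≤ ∂^{(∞)}(δ̃)`: no cyclic level, however SHALLOW, carries a Kurihara number less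
`3`-divisible than the deep limit. The cell's proof of record (HOME `kim3/KIM3-PROOF.md`, Theorem A
(iii), §4.4 (b)(c)) obtains it from three inputs:
 (D) the EXACT UNIFORM DICTIONARY `δ̃_n = u_n · p^e · x_n` in `ℤ_p/I_nℤ_p` at EVERY cyclic level `n`
     (Prop. D + Lemma K: `x_n` the singular coordinate at `p` of Kato's optimally normalised
     Kolyvagin class `κ_n`, `u_n` a unit, and ONE exponent `e = e(Ω⁺_f) = v₃(c₃) + v₃(c₀) + b ≥ 0`
     for all `n` — the sign `e ≥ 0` is where `E(ℚ₃)[3] = 0` and the period comparison of the sibling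
     file `KimAtThreeShallowEqDeepPeriod` enter);
 (J) `κ = p^{j₀} · κ⁰` with `κ⁰` primitive (`KS(T₃E)` free of rank one: MR04 + Sakamoto 2024 at
     `p = 3`, memo P6/P8), so `x_n ∈ p^{j₀}(ℤ_p/I_n)` at every level;
 (A) DEEP ATTAINMENT: for one `ν = i` and every depth `k` some cyclic `n ∈ 𝒩_k` with `ν(n) = i` has
     `x_n = p^{j₀} ·(unit)` (memo §5 Step 6: core vertices killing the Selmer group exist at every
     depth).
This file proves the `ℕ∞` half of that argument in the kernel, for general `p`, with (D)(J)(A) as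
DATA/HYPOTHESES spelled inline (`e j₀ : ℕ`, `x : ℕ → ℕ∞` = "`ord_p x_n`", valued in
`{0,…,k(n)−1} ∪ {⊤}`; (D) is read at every admissible depth `k`, `n ∈ 𝒩_k`, as
`min(k, ord_p δ̃_n) = min(k, e + x_n)` — faithful to "`δ̃_n = u·p^e·x_n` in `ℤ/p^{k(n)}`" including the
cap `ord(0) = ⊤`):

* `kuriharaDivisibleAt_of_not_isKolyvaginProduct_succ`, `kuriharaDivIndex_eq_top_of_divisibleAt_depth`
  — structure of the index: `ord_p δ̃_n ∈ {0,…,k(n)−1} ∪ {⊤}` (divisibility at the full depth of the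
  level is divisibility by every power);
* `coe_le_kuriharaDivIndex_of_forall_min_le` — a bound `min(k, c) ≤ ord_p δ̃_n` at EVERY admissible
  depth `k` is the bound `c ≤ ord_p δ̃_n` (the certificate behind a finite index lives at depth
  `ord + 1`);
* `le_kuriharaDivIndex_of_exactDictionary` — (D)+(J) at one level: `e + j₀ ≤ ord_p δ̃_n`;
* `le_kuriharaPartialInfty_of_exactDictionary`, `le_kuriharaPartialDeepInfty_of_exactDictionary` —
  (D)+(J): `e + j₀ ≤ ∂^{(∞)}(δ̃)` and `e + j₀ ≤ ∂^{(∞)}_{deep}(δ̃)`;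
* `kuriharaPartialDeepInfty_le_of_attainment`, `kuriharaPartialInfty_le_of_attainment` — (D)+(A):
  both functionals are `≤ e + j₀`;
* `shallow_eq_deep_of_exactDictionary` — (D)+(J)+(A): **`∂^{(∞)}_{deep}(δ̃) = ∂^{(∞)}(δ̃) = e + j₀`**
  (memo Theorem A (iii) / §4.4 (c3): `∂^{(∞)}_{inf}(δ) = ∂^{(∞)}(δ) = e + ∂^{(∞)}(x)`), and
  `kuriharaPartialDeepInfty_le_kuriharaPartialInfty_of_exactDictionary` — the crux's inequality;
* `e_add_j₀_eq_zero_of_unit` — under (D)+(J) a UNIT Kurihara number at ANY cyclic level forces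
  `e = j₀ = 0` (memo §4.4 (a″)(iv): "forces `e(Ω) = 0`: `3 ∤ c₃`, `3 ∤ c₀`" and `κ` primitive);
* `shallowEqDeepAtTorsionFree_of_exactDictionary` — item 19077 from the datum (D)(J)(A) on every row,
  as an INLINE hypothesis (the memo's Prop D + Lemma K + P6/P8 + Step 6 at `p = 3`, `t = 0`; NOT a
  tree fact, nothing asserted).

What this is NOT: a proof of the crux — the Kolyvagin coordinate `x_n` (Kato's class under
`exp*_𝓛 ∘ loc^s_3`) is not typed in the tree, so (D)(J)(A) stay hypotheses; the file isolates exactly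
what the analytic side must supply and shows that the sign `e ≥ 0` (an `e : ℕ`) is the whole
`t = 0` content on the `ℕ∞` side. [cite: Kim2022StructureSelmer, §1.5.1 (PDF p. 7), Def. 2.13 (PDF p. 14)]
[cite: MazurRubin2004, Def. 4.5.7, Def. 5.2.11, Thm. 5.2.12 (i)] [cite: Kim2025RefinedTNC, Thm 1.1, §4.2]
-/

set_option autoImplicit false
-- the Theorems namespace of a single-conjunct summit repeats the summit name by design (D-0017)
set_option linter.dupNamespace false

noncomputable section

open scoped MatrixGroups ModularForm Classical

open CongruenceSubgroup WeierstrassCurve Literature.NumberTheory.EllipticCurves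
  Literature.NumberTheory.EllipticCurves.ModularForms

namespace Summit.BirchSwinnertonDyer.BirchSwinnertonDyer.Theorems.KimAtThreeShallowEqDeepDictionary

open Summit.BirchSwinnertonDyer.Rank1Residual.Additive
open Summit.BirchSwinnertonDyer.BirchSwinnertonDyer.Theses.KimAtThreeKolyvagin
open Summit.BirchSwinnertonDyer.BirchSwinnertonDyer.Theorems.KimAtThreeKolyvaginCertificateDictionary

/-! ### Structure of the divisibility index of one Kurihara number (general `p`) -/

section Index

variable (W : WeierstrassCurve ℚ) [W.IsGloballyMinimal] (p : ℕ) {N : ℕ} (f : CuspForm (Gamma0 N) 2)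

/-- **Divisibility beyond the depth of the level is free.** If `n ∉ 𝒩_{k+1}` (the level has depth
`≤ k`, i.e. `I_n ⊇ p^kℤ_p`) and `δ̃_n ∈ p^k ℤ_p/I_n` (so `δ̃_n = 0` in `ℤ_p/I_n`), then
`δ̃_n ∈ p^j ℤ_p/I_n` for every `j`: the depths `k' > k` impose nothing.
[cite: Kim2022StructureSelmer, §1.4.3 and §1.5.1 (PDF p. 7)] -/
theorem kuriharaDivisibleAt_of_not_isKolyvaginProduct_succ {n k : ℕ}
    (hk : ¬ Kato.IsKolyvaginProduct W p (k + 1) n) (h : KuriharaDivisibleAt W p f n k) (j : ℕ) :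
    KuriharaDivisibleAt W p f n j := by
  intro k' hk' hkn ψ hψ
  by_cases hle : k' ≤ k
  · exact h k' hle hkn ψ hψ
  · exact absurd (hkn.mono (show k + 1 ≤ k' by omega)) hk

/-- **`ord_p δ̃_n ∈ {0, …, k(n) − 1} ∪ {⊤}`**: if `n ∉ 𝒩_{k+1}` and `δ̃_n ∈ p^k ℤ_p/I_n` then the index is
`⊤` ("`δ̃_n = 0` in `ℤ_p/I_nℤ_p` — no information", Kim Def. 2.13's convention).
[cite: Kim2022StructureSelmer, Def. 2.13 (PDF p. 14)] -/
theorem kuriharaDivIndex_eq_top_of_divisibleAt_depth {n k : ℕ}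
    (hk : ¬ Kato.IsKolyvaginProduct W p (k + 1) n) (h : KuriharaDivisibleAt W p f n k) :
    kuriharaDivIndex W p f n = ⊤ := by
  rw [ENat.eq_top_iff_forall_ge]
  intro j
  exact (coe_le_kuriharaDivIndex_iff W p f n j).mpr
    (kuriharaDivisibleAt_of_not_isKolyvaginProduct_succ W p f hk h j)

/-- **A bound at every admissible depth is a bound on the index.** If `min(k, c) ≤ ord_p δ̃_n` for
every depth `k` with `n ∈ 𝒩_k`, then `c ≤ ord_p δ̃_n`: were the index `m < c` finite, the certificate
`δ̃_n ∉ p^{m+1}ℤ_p/I_n` behind it would be witnessed at the depth `k = m + 1` exactly (shallower depths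
are excluded by `δ̃_n ∈ p^mℤ_p/I_n`), where the hypothesis reads `m + 1 ≤ m`.
[cite: Kim2022StructureSelmer, §1.5.1 (PDF p. 7), Def. 2.13 (PDF p. 14)] -/
theorem coe_le_kuriharaDivIndex_of_forall_min_le {n c : ℕ}
    (h : ∀ k, Kato.IsKolyvaginProduct W p k n → min (k : ℕ∞) (c : ℕ∞) ≤ kuriharaDivIndex W p f n) :
    (c : ℕ∞) ≤ kuriharaDivIndex W p f n := by
  by_contra hlt
  push Not at hlt
  obtain ⟨m, hm⟩ : ∃ m : ℕ, (m : ℕ∞) = kuriharaDivIndex W p f n :=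
    ENat.ne_top_iff_exists.mp (hlt.trans_le le_top).ne
  have hmc : m < c := by
    rw [← hm] at hlt
    exact_mod_cast hlt
  -- the certificate of depth `m + 1` and the divisibility at `m`
  have hcert : ¬ KuriharaDivisibleAt W p f n (m + 1) := (kuriharaDivIndex_le_coe_iff W p f n m).mp hm.ge
  have hdiv : KuriharaDivisibleAt W p f n m := (coe_le_kuriharaDivIndex_iff W p f n m).mp hm.le
  obtain ⟨k, -, hkm, hk, ψ, hψ, hne⟩ :=
    exists_kuriharaNumber_ne_zero_of_not_kuriharaDivisibleAt W p f hcert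
  by_cases hle : k ≤ m
  · exact hne (hdiv k hle hk ψ hψ)
  · obtain rfl : k = m + 1 := by omega
    have h' := h (m + 1) hk
    rw [← hm, min_eq_left (by exact_mod_cast hmc : ((m + 1 : ℕ) : ℕ∞) ≤ (c : ℕ∞))] at h'
    have h'' : m + 1 ≤ m := by exact_mod_cast h'
    omega

end Index

/-! ### The exact uniform dictionary (general `p`): (D), (J), (A) as inline data -/

section Dictionary

variable (W : WeierstrassCurve ℚ) [W.IsGloballyMinimal] (p : ℕ) {N : ℕ} (f : CuspForm (Gamma0 N) 2)

/-- **(D)+(J) at one level: `e + j₀ ≤ ord_p δ̃_n`.** If at every admissible depth `k` of the cyclic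
level `n` the dictionary reads `min(k, ord_p δ̃_n) = min(k, e + x_n)` and `j₀ ≤ x_n`, then
`min(k, e + j₀) ≤ ord_p δ̃_n` at every such `k`, hence `e + j₀ ≤ ord_p δ̃_n`
(`coe_le_kuriharaDivIndex_of_forall_min_le`). (Memo §4.4 (c): "`ord₃(δ_n) = e + ord₃(x_n)` if
`e + ord₃(x_n) < k(n)`, and `= ∞` otherwise".) [cite: Kim2025RefinedTNC, §4.2 (PDF p. 22)]
[cite: Kim2022StructureSelmer, Def. 2.13 (PDF p. 14)] -/
theorem le_kuriharaDivIndex_of_exactDictionary (e j₀ : ℕ) (x : ℕ → ℕ∞) {n : ℕ}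
    (hD : ∀ k, Kato.IsKolyvaginProduct W p k n →
      min (k : ℕ∞) (kuriharaDivIndex W p f n) = min (k : ℕ∞) ((e : ℕ∞) + x n))
    (hJ : (j₀ : ℕ∞) ≤ x n) :
    ((e + j₀ : ℕ) : ℕ∞) ≤ kuriharaDivIndex W p f n := by
  refine coe_le_kuriharaDivIndex_of_forall_min_le W p f fun k hk => ?_
  calc min (k : ℕ∞) ((e + j₀ : ℕ) : ℕ∞)
      ≤ min (k : ℕ∞) ((e : ℕ∞) + x n) := by
        refine min_le_min le_rfl ?_
        push_cast
        exact add_le_add_right hJ (e : ℕ∞)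
    _ = min (k : ℕ∞) (kuriharaDivIndex W p f n) := (hD k hk).symm
    _ ≤ kuriharaDivIndex W p f n := min_le_right _ _

/-- **(D)+(J) ⟹ `e + j₀ ≤ ∂^{(∞)}(δ̃)`** — the ALL-LEVELS (shallow) infimum: every cyclic level,
however shallow, has `ord_p δ̃_n ≥ e + j₀`. This is the inequality that FAILS for `e < 0` (memo
§4.4 (c4): "shallow unit Kurihara numbers carry no information about `x`"), i.e. at `t ≥ 1`.
[cite: Kim2022StructureSelmer, §1.5.1 (PDF p. 7)] [cite: Kim2025RefinedTNC, Thm 1.1] -/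
theorem le_kuriharaPartialInfty_of_exactDictionary (e j₀ : ℕ) (x : ℕ → ℕ∞)
    (hD : ∀ n k, IsCyclicKolyvaginLevel W p n → Kato.IsKolyvaginProduct W p k n →
      min (k : ℕ∞) (kuriharaDivIndex W p f n) = min (k : ℕ∞) ((e : ℕ∞) + x n))
    (hJ : ∀ n, IsCyclicKolyvaginLevel W p n → (j₀ : ℕ∞) ≤ x n) :
    ((e + j₀ : ℕ) : ℕ∞) ≤ kuriharaPartialInfty W p f := by
  refine le_iInf fun i => ?_
  rw [kuriharaPartial_def]
  refine le_iInf fun n => le_iInf fun hn => le_iInf fun _ => ?_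
  exact le_kuriharaDivIndex_of_exactDictionary W p f e j₀ x (fun k hk => hD n k hn hk) (hJ n hn)

/-- **(D)+(J) ⟹ `e + j₀ ≤ ∂^{(∞)}_{deep}(δ̃)`**: at the depth `k = e + j₀` every cyclic `n ∈ 𝒩_k`
with any `ν(n)` has `δ̃_n ∈ p^{e+j₀}ℤ_p/I_n`, so `∂^{(i)}(δ̃^{(k)}) ≥ e + j₀` for every `i`.
[cite: MazurRubin2004, Def. 4.5.7, Def. 5.2.11] -/
theorem le_kuriharaPartialDeepInfty_of_exactDictionary (e j₀ : ℕ) (x : ℕ → ℕ∞)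
    (hD : ∀ n k, IsCyclicKolyvaginLevel W p n → Kato.IsKolyvaginProduct W p k n →
      min (k : ℕ∞) (kuriharaDivIndex W p f n) = min (k : ℕ∞) ((e : ℕ∞) + x n))
    (hJ : ∀ n, IsCyclicKolyvaginLevel W p n → (j₀ : ℕ∞) ≤ x n) :
    ((e + j₀ : ℕ) : ℕ∞) ≤ kuriharaPartialDeepInfty W p f := by
  refine le_iInf fun i => ?_
  refine (coe_le_kuriharaPartialDeep_iff W p f i (e + j₀)).mpr ⟨e + j₀, ?_⟩
  refine (coe_le_kuriharaPartialDeepAt_iff W p f (e + j₀) i (e + j₀)).mpr fun n hn hk _ => ⟨le_rfl, ?_⟩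
  exact (coe_le_kuriharaDivIndex_iff W p f n (e + j₀)).mp
    (le_kuriharaDivIndex_of_exactDictionary W p f e j₀ x (fun k' hk' => hD n k' hn hk') (hJ n hn))

/-- **(D)+(A) ⟹ `∂^{(∞)}_{deep}(δ̃) ≤ e + j₀`**: at every depth `k` the attaining level `n ∈ 𝒩_k`
(`ν(n) = i`, `x_n = j₀`) has `min(k, ord_p δ̃_n) = min(k, e + j₀) ≤ e + j₀`, so
`∂^{(i)}(δ̃^{(k)}) ≤ e + j₀` for every `k` and `∂^{(∞)}_{deep} ≤ ∂^{(i)}_{deep} ≤ e + j₀`.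
[cite: MazurRubin2004, Def. 4.5.7, Thm. 5.2.12 (i)] -/
theorem kuriharaPartialDeepInfty_le_of_attainment (e j₀ : ℕ) (x : ℕ → ℕ∞)
    (hD : ∀ n k, IsCyclicKolyvaginLevel W p n → Kato.IsKolyvaginProduct W p k n →
      min (k : ℕ∞) (kuriharaDivIndex W p f n) = min (k : ℕ∞) ((e : ℕ∞) + x n))
    {i : ℕ} (hA : ∀ k, ∃ n, IsCyclicKolyvaginLevel W p n ∧ Kato.IsKolyvaginProduct W p k n ∧
      n.primeFactors.card = i ∧ x n = j₀) :
    kuriharaPartialDeepInfty W p f ≤ ((e + j₀ : ℕ) : ℕ∞) := by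
  refine (kuriharaPartialDeepInfty_le W p f i).trans ?_
  refine (kuriharaPartialDeep_le_coe_iff W p f i (e + j₀)).mpr fun k => ?_
  obtain ⟨n, hn, hk, hi, hx⟩ := hA k
  refine (kuriharaPartialDeepAt_le W p f hn hk hi).trans ?_
  rw [hD n k hn hk, hx]
  push_cast
  exact min_le_right _ _

/-- **(D)+(A) ⟹ `∂^{(∞)}(δ̃) ≤ e + j₀`** (the shallow infimum is attained too): the attaining level at
depth `k = e + j₀ + 1` has `min(e+j₀+1, ord_p δ̃_n) = e + j₀`, i.e. `ord_p δ̃_n = e + j₀` exactly.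
[cite: Kim2022StructureSelmer, §1.5.1 (PDF p. 7)] -/
theorem kuriharaPartialInfty_le_of_attainment (e j₀ : ℕ) (x : ℕ → ℕ∞)
    (hD : ∀ n k, IsCyclicKolyvaginLevel W p n → Kato.IsKolyvaginProduct W p k n →
      min (k : ℕ∞) (kuriharaDivIndex W p f n) = min (k : ℕ∞) ((e : ℕ∞) + x n))
    {i : ℕ} (hA : ∀ k, ∃ n, IsCyclicKolyvaginLevel W p n ∧ Kato.IsKolyvaginProduct W p k n ∧
      n.primeFactors.card = i ∧ x n = j₀) :
    kuriharaPartialInfty W p f ≤ ((e + j₀ : ℕ) : ℕ∞) := by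
  obtain ⟨n, hn, hk, hi, hx⟩ := hA (e + j₀ + 1)
  refine (kuriharaPartialInfty_le W p f i).trans ((kuriharaPartial_le W p f hn hi).trans ?_)
  have h := hD n (e + j₀ + 1) hn hk
  rw [hx] at h
  have hlt : ((e + j₀ : ℕ) : ℕ∞) < ((e + j₀ + 1 : ℕ) : ℕ∞) := by exact_mod_cast Nat.lt_succ_self _
  have hrhs : min ((e + j₀ + 1 : ℕ) : ℕ∞) ((e : ℕ∞) + (j₀ : ℕ)) = ((e + j₀ : ℕ) : ℕ∞) := by
    push_cast
    exact min_eq_right (by exact_mod_cast Nat.le_succ _)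
  rw [hrhs] at h
  -- `min (e+j₀+1) (ord δ̃_n) = e + j₀ < e + j₀ + 1` forces `ord δ̃_n = e + j₀`
  rcases min_choice ((e + j₀ + 1 : ℕ) : ℕ∞) (kuriharaDivIndex W p f n) with hmin | hmin
  · rw [hmin] at h
    exact absurd h hlt.ne'
  · rw [hmin] at h
    exact h.le

/-- **THE EXACT UNIFORM DICTIONARY THEOREM (memo Theorem A (iii) / §4.4 (c), `ℕ∞` side, general `p`).**
Given `e j₀ : ℕ` and `x : ℕ → ℕ∞` with
 (D) `min(k, ord_p δ̃_n) = min(k, e + x_n)` at every cyclic level `n` and every depth `k` with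
     `n ∈ 𝒩_k` (the dictionary `δ̃_n = u_n p^e x_n` EXACTLY in `ℤ_p/I_n`, ONE exponent `e ≥ 0`);
 (J) `j₀ ≤ x_n` at every cyclic level (`κ = p^{j₀}κ⁰`);
 (A) for some `i`, at every depth `k` a cyclic `n ∈ 𝒩_k` with `ν(n) = i` and `x_n = j₀` (deep
     attainment by the primitive system):
**`∂^{(∞)}_{deep}(δ̃) = e + j₀ = ∂^{(∞)}(δ̃)`** — shallow and deep invariants coincide and both equal
`e + ∂^{(∞)}(κ)`. [cite: MazurRubin2004, Def. 5.2.11, Thm. 5.2.12 (i)]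
[cite: Kim2022StructureSelmer, §1.5.1 (PDF p. 7)] [cite: Kim2025RefinedTNC, Thm 1.1, §4.2 (PDF p. 22)] -/
theorem shallow_eq_deep_of_exactDictionary (e j₀ : ℕ) (x : ℕ → ℕ∞)
    (hD : ∀ n k, IsCyclicKolyvaginLevel W p n → Kato.IsKolyvaginProduct W p k n →
      min (k : ℕ∞) (kuriharaDivIndex W p f n) = min (k : ℕ∞) ((e : ℕ∞) + x n))
    (hJ : ∀ n, IsCyclicKolyvaginLevel W p n → (j₀ : ℕ∞) ≤ x n)
    (hA : ∃ i, ∀ k, ∃ n, IsCyclicKolyvaginLevel W p n ∧ Kato.IsKolyvaginProduct W p k n ∧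
      n.primeFactors.card = i ∧ x n = j₀) :
    kuriharaPartialDeepInfty W p f = ((e + j₀ : ℕ) : ℕ∞) ∧
      kuriharaPartialInfty W p f = ((e + j₀ : ℕ) : ℕ∞) := by
  obtain ⟨i, hA⟩ := hA
  exact ⟨le_antisymm (kuriharaPartialDeepInfty_le_of_attainment W p f e j₀ x hD hA)
      (le_kuriharaPartialDeepInfty_of_exactDictionary W p f e j₀ x hD hJ),
    le_antisymm (kuriharaPartialInfty_le_of_attainment W p f e j₀ x hD hA)
      (le_kuriharaPartialInfty_of_exactDictionary W p f e j₀ x hD hJ)⟩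

/-- **(D)+(J)+(A) ⟹ the conclusion of crux `ShallowEqDeepAtTorsionFree`**:
`∂^{(∞)}_{deep}(δ̃) ≤ ∂^{(∞)}(δ̃)` (indeed `=`). [cite: Kim2025RefinedTNC, Thm 1.1]
[cite: MazurRubin2004, Thm. 5.2.12 (i)] -/
theorem kuriharaPartialDeepInfty_le_kuriharaPartialInfty_of_exactDictionary (e j₀ : ℕ) (x : ℕ → ℕ∞)
    (hD : ∀ n k, IsCyclicKolyvaginLevel W p n → Kato.IsKolyvaginProduct W p k n →
      min (k : ℕ∞) (kuriharaDivIndex W p f n) = min (k : ℕ∞) ((e : ℕ∞) + x n))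
    (hJ : ∀ n, IsCyclicKolyvaginLevel W p n → (j₀ : ℕ∞) ≤ x n)
    (hA : ∃ i, ∀ k, ∃ n, IsCyclicKolyvaginLevel W p n ∧ Kato.IsKolyvaginProduct W p k n ∧
      n.primeFactors.card = i ∧ x n = j₀) :
    kuriharaPartialDeepInfty W p f ≤ kuriharaPartialInfty W p f := by
  obtain ⟨hd, hs⟩ := shallow_eq_deep_of_exactDictionary W p f e j₀ x hD hJ hA
  rw [hd, hs]

/-- **The WEAKER sufficient condition without attainment data**: (D)+(J) together with the single
inequality `∂^{(∞)}_{deep}(δ̃) ≤ e + j₀` already give the crux's conclusion (attainment (A) is only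
used to prove that inequality, `kuriharaPartialDeepInfty_le_of_attainment`).
[cite: MazurRubin2004, Def. 5.2.11] [cite: Kim2025RefinedTNC, Thm 1.1] -/
theorem kuriharaPartialDeepInfty_le_kuriharaPartialInfty_of_dictionary_of_le (e j₀ : ℕ) (x : ℕ → ℕ∞)
    (hD : ∀ n k, IsCyclicKolyvaginLevel W p n → Kato.IsKolyvaginProduct W p k n →
      min (k : ℕ∞) (kuriharaDivIndex W p f n) = min (k : ℕ∞) ((e : ℕ∞) + x n))
    (hJ : ∀ n, IsCyclicKolyvaginLevel W p n → (j₀ : ℕ∞) ≤ x n)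
    (hle : kuriharaPartialDeepInfty W p f ≤ ((e + j₀ : ℕ) : ℕ∞)) :
    kuriharaPartialDeepInfty W p f ≤ kuriharaPartialInfty W p f :=
  hle.trans (le_kuriharaPartialInfty_of_exactDictionary W p f e j₀ x hD hJ)

/-- **Under (D)+(J), a UNIT Kurihara number at ANY cyclic level forces `e = 0` and `j₀ = 0`**
(memo §4.4 (a″)(iv): a unit `δ̃_n(Ω)` at any cyclic level forces `e(Ω) = 0` — `3 ∤ c₃`, `3 ∤ c₀`,
`b = 0` — and Kato's system primitive, `j₀ = 0`; the reading behind the cell's per-pair certificates).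
[cite: Kim2025RefinedTNC, §4.2 (PDF p. 22)] [cite: Kim2022StructureSelmer, §1.5.1 (PDF p. 7)] -/
theorem e_add_j₀_eq_zero_of_unit (e j₀ : ℕ) (x : ℕ → ℕ∞) {n : ℕ} [NeZero n]
    (hn : IsCyclicKolyvaginLevel W p n)
    (hD : ∀ k, Kato.IsKolyvaginProduct W p k n →
      min (k : ℕ∞) (kuriharaDivIndex W p f n) = min (k : ℕ∞) ((e : ℕ∞) + x n))
    (hJ : (j₀ : ℕ∞) ≤ x n)
    (ψ : (ℓ : ℕ) → (ZMod ℓ)ˣ →* Multiplicative (ZMod (p ^ 1)))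
    (hψ : ∀ ℓ ∈ n.primeFactors, Function.Surjective (ψ ℓ))
    (hunit : kuriharaNumber f (p ^ 1) n ψ ≠ 0) : e + j₀ = 0 := by
  have h0 : kuriharaDivIndex W p f n = 0 := kuriharaDivIndex_eq_zero_of_ne_zero W p f hn.1 ψ hψ hunit
  have h := le_kuriharaDivIndex_of_exactDictionary W p f e j₀ x hD hJ
  rw [h0] at h
  exact_mod_cast nonpos_iff_eq_zero.mp h

end Dictionary

/-! ### Item 19077 from the dictionary datum on every row (inline hypothesis, not a tree fact) -/

/-- **Crux `ShallowEqDeepAtTorsionFree` ⟸ the exact uniform dictionary on every row.** Hypothesis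
`H` (INLINE; the cell memo's Prop. D + Lemma K + P6/P8 + §5 Step 6 at `p = 3` under the tower and
`E(ℚ₃)[3] = 0`, with `e = e(Ω⁺_f) = v₃(c₃) + v₃(c₀) ≥ 0` — NOT a tree fact, nothing asserted): on every
row of the crux there are `e j₀ : ℕ` and `x : ℕ → ℕ∞` satisfying (D), (J), (A). Then item
`stmt-BirchSwinnertonDyer-19077` holds. The binder `Nat.card {Q // 3 • Q = 0} = 1` is consumed by `H`
(it is what makes ONE exponent `e ≥ 0` serve every level); at `t ≥ 1` no such datum exists (memo §19,
kit tests P2). [cite: Kim2025RefinedTNC, Thm 1.1, §4.2 (PDF p. 22)] [cite: MazurRubin2004, Thm. 5.2.12 (i)]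
[cite: Sakamoto2024KolyvaginThree, Thm. 4.4] -/
theorem shallowEqDeepAtTorsionFree_of_exactDictionary
    (H : ∀ (W : WeierstrassCurve ℚ) [W.IsElliptic] [W.IsGloballyMinimal],
      (∀ n : ℕ, W.HasSurjectiveModNGaloisRep (3 ^ n : ℕ)) →
      Nat.card {Q : (W.baseChange ℚ_[3]).toAffine.Point // (3 : ℕ) • Q = 0} = 1 → Finite W.sha →
      ∀ {N : ℕ} [NeZero N] (f : CuspForm (Gamma0 N) 2), IsNewformOf W f →
      (∀ r : ℚ, ratPlusSymbol f r ≠ 0 → 0 ≤ padicValRat 3 (ratPlusSymbol f r)) →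
      kuriharaVanishingOrder W 3 f = 0 →
      ∃ (e j₀ : ℕ) (x : ℕ → ℕ∞),
        (∀ n k, IsCyclicKolyvaginLevel W 3 n → Kato.IsKolyvaginProduct W 3 k n →
          min (k : ℕ∞) (kuriharaDivIndex W 3 f n) = min (k : ℕ∞) ((e : ℕ∞) + x n)) ∧
        (∀ n, IsCyclicKolyvaginLevel W 3 n → (j₀ : ℕ∞) ≤ x n) ∧
        (∃ i, ∀ k, ∃ n, IsCyclicKolyvaginLevel W 3 n ∧ Kato.IsKolyvaginProduct W 3 k n ∧
          n.primeFactors.card = i ∧ x n = j₀)) :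
    ShallowEqDeepAtTorsionFree := by
  intro W _ _ htower ht0 hfin N _ f hf hint hord
  obtain ⟨e, j₀, x, hD, hJ, hA⟩ := H W htower ht0 hfin f hf hint hord
  exact kuriharaPartialDeepInfty_le_kuriharaPartialInfty_of_exactDictionary W 3 f e j₀ x hD hJ hA

/-- **… and the dictionary datum gives the LEAF's shape on that row as a by-product**: `∂^{(∞)}(δ̃)` is
the natural number `e + j₀` (the quantity Kim's formula subtracts; Conj. 1.10 of Kim 2026 / Conj. 7.4
of Kim 2025 predicts `e + j₀ = Σ_ℓ v_p(c_ℓ)` in the Néron normalisation).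
[cite: Kim2022StructureSelmer, Conj. 1.10 (PDF p. 8), §1.5.1 (PDF p. 7)] [cite: Kim2025RefinedTNC, Conj. 7.4 (PDF p. 32)] -/
theorem kuriharaPartialInfty_eq_of_exactDictionary (W : WeierstrassCurve ℚ) [W.IsGloballyMinimal]
    (p : ℕ) {N : ℕ} (f : CuspForm (Gamma0 N) 2) (e j₀ : ℕ) (x : ℕ → ℕ∞)
    (hD : ∀ n k, IsCyclicKolyvaginLevel W p n → Kato.IsKolyvaginProduct W p k n →
      min (k : ℕ∞) (kuriharaDivIndex W p f n) = min (k : ℕ∞) ((e : ℕ∞) + x n))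
    (hJ : ∀ n, IsCyclicKolyvaginLevel W p n → (j₀ : ℕ∞) ≤ x n)
    (hA : ∃ i, ∀ k, ∃ n, IsCyclicKolyvaginLevel W p n ∧ Kato.IsKolyvaginProduct W p k n ∧
      n.primeFactors.card = i ∧ x n = j₀) :
    ∃ d : ℕ, kuriharaPartialInfty W p f = d ∧ kuriharaPartialDeepInfty W p f = d ∧ d = e + j₀ :=
  ⟨e + j₀, (shallow_eq_deep_of_exactDictionary W p f e j₀ x hD hJ hA).2,
    (shallow_eq_deep_of_exactDictionary W p f e j₀ x hD hJ hA).1, rfl⟩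

end Summit.BirchSwinnertonDyer.BirchSwinnertonDyer.Theorems.KimAtThreeShallowEqDeepDictionary

end
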